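import Literature.MathematicalPhysics.QuantumFieldTheory.TorusPlaquetteNeighbours

/-!
HONEST FRAMING: exact (Metropolis-corrected) sampling algorithms for lattice gauge theory; figures
of merit are autocorrelation/cost numbers at stated couplings and volumes; no continuum-physics
claim.

# PlaquetteSparseFamily — EVERY SET `D` OF PLAQUETTES CONTAINS A SUBFAMILY `M`, `#D ≤ (8d(d−1)+1)·#M`,
# WHOSE FIRST LINKS HAVE PAIRWISE DISJOINT PLAQUETTE SETS (greedy independent set in a conflict
# graph of degree `≤ 8d(d−1)`; lean-1 GEN-11, ours; part 4 of 5 of the defect specific-heat floor)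

Venture-side (OURS). Cell `lqcd-flow` (pub-lqcd), unit `pub-lqcd-lean-1-g11`, 2026-08-23.  Pure
combinatorics (no measure theory), used by `DefectVarianceFloor` to make the floor EXTENSIVE IN THE
DEFECT for an arbitrary defect `D`:

* §1 `exists_sparse_subfamily` — in a finite set `s` with a symmetric conflict relation `R` in
  which every element conflicts with at most `k` others, the greedy procedure (keep an element,
  discard its conflicts, repeat) yields a conflict-free `t ⊆ s` with `#s ≤ (k+1)·#t`.
* §2 on the torus `(ℤ/L)^d`: two plaquettes CONFLICT when the plaquette sets of their first links
  `(y, i)` (for `p = (y; i<j)`) intersect; a plaquette conflicts with at most `8d(d−1)` others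
  (`card_conflicts_le`: the other first link must be one of the `≤ 4·2(d−1)` edges of the
  plaquettes through `(y, i)`, and at most `d` plaquettes share a first link), whence
  **`exists_sparse_plaquette_family`**: `∃ M ⊆ D`, first links with pairwise DISJOINT plaquette sets,
  `#D ≤ (8d(d−1)+1)·#M`.

NOT CLAIMED: the optimal constant (a lattice colouring would give `#D/O(d)`).  [folklore]
-/

namespace Summit.Ventures.LatticeQCDFlow.Theory2.DefectFloor

open Finset Literature.MathematicalPhysics.QuantumFieldTheory

/-! ## §1 Greedy conflict-free subfamily -/

section Greedy

variable {α : Type*} [DecidableEq α]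

/-- **Greedy independent set.**  If `R` is symmetric and every `x ∈ s` conflicts with at most `k`
other elements of `s`, then some `t ⊆ s` is conflict-free with `#s ≤ (k+1)·#t`. [folklore] -/
theorem exists_sparse_subfamily (R : α → α → Prop) [DecidableRel R] (hR : ∀ {x y}, R x y → R y x)
    (k : ℕ)
    (s : Finset α) (hdeg : ∀ x ∈ s, ((s.erase x).filter (R x)).card ≤ k) :
    ∃ t ⊆ s, (∀ x ∈ t, ∀ y ∈ t, x ≠ y → ¬ R x y) ∧ s.card ≤ (k + 1) * t.card := by
  induction s using Finset.strongInduction with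
  | H s ih =>
    rcases s.eq_empty_or_nonempty with rfl | ⟨x, hx⟩
    · exact ⟨∅, Finset.empty_subset _, by simp, by simp⟩
    · set s' := (s.erase x).filter (fun y => ¬ R x y) with hs'
      have hs'sub : s' ⊆ s := (Finset.filter_subset _ _).trans (Finset.erase_subset _ _)
      have hxs' : x ∉ s' := by simp [hs']
      have hs'ss : s' ⊂ s := Finset.ssubset_iff_subset_ne.2 ⟨hs'sub, fun h => hxs' (h ▸ hx)⟩
      have hdeg' : ∀ y ∈ s', ((s'.erase y).filter (R y)).card ≤ k := fun y hy =>
        (Finset.card_le_card (Finset.filter_subset_filter _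
          (Finset.erase_subset_erase _ hs'sub))).trans (hdeg y (hs'sub hy))
      obtain ⟨t', ht'sub, ht'ind, ht'card⟩ := ih s' hs'ss hdeg'
      have hxt' : x ∉ t' := fun h => hxs' (ht'sub h)
      refine ⟨insert x t', Finset.insert_subset hx (ht'sub.trans hs'sub), ?_, ?_⟩
      · intro y hy z hz hyz
        rcases Finset.mem_insert.1 hy with rfl | hy'
        · rcases Finset.mem_insert.1 hz with rfl | hz'
          · exact absurd rfl hyz
          · exact (Finset.mem_filter.1 (ht'sub hz')).2
        · rcases Finset.mem_insert.1 hz with rfl | hz'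
          · exact fun h => (Finset.mem_filter.1 (ht'sub hy')).2 (hR h)
          · exact ht'ind y hy' z hz' hyz
      · rw [Finset.card_insert_of_notMem hxt']
        have h1 : (s.erase x).card + 1 = s.card := Finset.card_erase_add_one hx
        have h2 : ((s.erase x).filter (R x)).card + s'.card = (s.erase x).card :=
          Finset.card_filter_add_card_filter_not _
        have h3 := hdeg x hx
        nlinarith [ht'card, h1, h2, h3]

end Greedy

/-! ## §2 The conflict graph of plaquettes on the torus -/

section Torus

variable {d L : ℕ} [NeZero L]

/-- At most `d` plaquettes have a given first link (they differ in the second direction).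
[folklore] -/
theorem card_filter_fst_eq_le (e : Edge d L) :
    ((univ : Finset (Plaquette d L)).filter (fun q => ((q.1, q.2.1.1) : Edge d L) = e)).card ≤ d := by
  classical
  have hinj : Set.InjOn (fun q : Plaquette d L => q.2.1.2)
      ↑((univ : Finset (Plaquette d L)).filter (fun q => ((q.1, q.2.1.1) : Edge d L) = e)) := by
    intro q hq q' hq' hj
    simp only [coe_filter, mem_univ, true_and, Set.mem_setOf_eq] at hq hq'
    have h1 : q.1 = q'.1 := (congrArg Prod.fst hq).trans (congrArg Prod.fst hq').symm
    have h2 : q.2.1.1 = q'.2.1.1 := (congrArg Prod.snd hq).trans (congrArg Prod.snd hq').symm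
    exact Prod.ext h1 (Subtype.ext (Prod.ext h2 hj))
  calc ((univ : Finset (Plaquette d L)).filter (fun q => ((q.1, q.2.1.1) : Edge d L) = e)).card
      ≤ (univ : Finset (Fin d)).card :=
        Finset.card_le_card_of_injOn (fun q => q.2.1.2) (fun _ _ => mem_univ _) hinj
    _ = d := by rw [card_univ, Fintype.card_fin]

/-- **Conflict degree.**  A plaquette `p` conflicts (the plaquette sets of the first links
intersect) with at most `8d(d−1)` other plaquettes of any set `D`. [folklore] -/
theorem card_conflicts_le (D : Finset (Plaquette d L)) (p : Plaquette d L) :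
    ((D.erase p).filter (fun q => ¬ Disjoint (plaqsThrough ((p.1, p.2.1.1) : Edge d L))
        (plaqsThrough ((q.1, q.2.1.1) : Edge d L)))).card ≤ 8 * d * (d - 1) := by
  classical
  set S : Finset (Edge d L) := (plaqsThrough ((p.1, p.2.1.1) : Edge d L)).biUnion plaqEdgesT
    with hS
  -- (i) a conflicting plaquette has its first link among the edges of the plaquettes through `e_p`
  have hsub : (D.erase p).filter (fun q => ¬ Disjoint (plaqsThrough ((p.1, p.2.1.1) : Edge d L))
        (plaqsThrough ((q.1, q.2.1.1) : Edge d L)))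
      ⊆ S.biUnion (fun e => (univ : Finset (Plaquette d L)).filter
          (fun q => ((q.1, q.2.1.1) : Edge d L) = e)) := by
    intro q hq
    obtain ⟨-, hq⟩ := mem_filter.1 hq
    obtain ⟨r, hr1, hr2⟩ := not_disjoint_iff.1 hq
    refine mem_biUnion.2 ⟨(q.1, q.2.1.1), ?_, mem_filter.2 ⟨mem_univ _, rfl⟩⟩
    exact mem_biUnion.2 ⟨r, hr1, mem_plaqsThrough.1 hr2⟩
  -- (ii) `#S ≤ 4 · 2(d−1)`
  have hScard : S.card ≤ 2 * (d - 1) * 4 := by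
    refine (card_biUnion_le).trans ?_
    calc ∑ r ∈ plaqsThrough ((p.1, p.2.1.1) : Edge d L), (plaqEdgesT r).card
        ≤ ∑ _r ∈ plaqsThrough ((p.1, p.2.1.1) : Edge d L), 4 :=
          sum_le_sum fun r _ => card_plaqEdgesT_le r
      _ = (plaqsThrough ((p.1, p.2.1.1) : Edge d L)).card * 4 := by rw [sum_const, smul_eq_mul]
      _ ≤ 2 * (d - 1) * 4 := Nat.mul_le_mul_right 4 (card_plaqsThrough_le _)
  -- (iii) assemble
  calc ((D.erase p).filter (fun q => ¬ Disjoint (plaqsThrough ((p.1, p.2.1.1) : Edge d L))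
          (plaqsThrough ((q.1, q.2.1.1) : Edge d L)))).card
      ≤ (S.biUnion (fun e => (univ : Finset (Plaquette d L)).filter
          (fun q => ((q.1, q.2.1.1) : Edge d L) = e))).card := card_le_card hsub
    _ ≤ ∑ e ∈ S, ((univ : Finset (Plaquette d L)).filter
          (fun q => ((q.1, q.2.1.1) : Edge d L) = e)).card := card_biUnion_le
    _ ≤ ∑ _e ∈ S, d := sum_le_sum fun e _ => card_filter_fst_eq_le e
    _ = S.card * d := by rw [sum_const, smul_eq_mul]
    _ ≤ 2 * (d - 1) * 4 * d := Nat.mul_le_mul_right d hScard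
    _ = 8 * d * (d - 1) := by ring

/-- **SPARSE SUBFAMILY OF A DEFECT.**  Every finite set `D` of plaquettes of the torus contains a
subfamily `M` whose first links have pairwise DISJOINT plaquette sets, with
`#D ≤ (8d(d−1)+1)·#M`. [folklore] -/
theorem exists_sparse_plaquette_family (D : Finset (Plaquette d L)) :
    ∃ M ⊆ D, (∀ p ∈ M, ∀ q ∈ M, p ≠ q →
        Disjoint (plaqsThrough ((p.1, p.2.1.1) : Edge d L)) (plaqsThrough ((q.1, q.2.1.1) : Edge d L)))
      ∧ D.card ≤ (8 * d * (d - 1) + 1) * M.card := by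
  classical
  obtain ⟨M, hMsub, hMind, hMcard⟩ := exists_sparse_subfamily
    (fun p q : Plaquette d L => ¬ Disjoint (plaqsThrough ((p.1, p.2.1.1) : Edge d L))
      (plaqsThrough ((q.1, q.2.1.1) : Edge d L)))
    (fun h => fun h' => h (disjoint_comm.1 h')) (8 * d * (d - 1)) D (fun p _ => card_conflicts_le D p)
  exact ⟨M, hMsub, fun p hp q hq hpq => not_not.1 (hMind p hp q hq hpq), hMcard⟩

end Torus

end Summit.Ventures.LatticeQCDFlow.Theory2.DefectFloor
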